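import Literature.Combinatorics.Enumerative.DombDworkCongruences
import HarnessLib

/-!
# Dwork congruences for the Yang–Zudilin numbers `Σ_k C(n,k)⁴` (Gorodetsky 2021, Prop. 3.3 row `s_10`)

Topic `Literature/Combinatorics/Enumerative`, namespace `Literature.Combinatorics.Enumerative.YangZudilinDworkCongruences`
(continues `SporadicDworkCongruences`, `DombDworkCongruences`).

Source, read on the page: O. Gorodetsky, *New representations for all sporadic Apéry-like sequences, with
applications to congruences*, Exp. Math. **32** (2023) 641–656 = arXiv:2102.11839 [Gorodetsky2021]:
**Proposition 3.3**, row `s_10`: the Laurent polynomial `(xyz)^{−1}(x+1)(y+1)(z+1)(xyz+1)` has constant term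
series the g.f. of `s_10` (§1.1: Cooper's `s_10`, the Yang–Zudilin numbers `Σ_k C(n,k)⁴`, cf. §1.3:
"`u^{(r,s,ε)}` include … `s_10`"); **Theorem 1.1** / §3.6 (Newton polytope); **Corollary 2.4** with **Theorem 2.3**
([SamolVanstraten2015], [MellitVlasenko2016]): `s_10` satisfies the D3 (Dwork) congruences.

What is formalised (everything PROVED, no named facts): `yzNumer`/`yzLaurent`; the constant-term identity
**`ctPow_yzLaurent : CT[Λ^n] = Σ_k C(n,k)⁴`** (= the tree's `AperyLucasCongruences.genApery 4 0 n`; three coefficient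
extractions `[x_1^n]`, `[x_2^n]`, `[x_3^n]`, each contributing one factor `C(n,k)`); `toLaurent_yzNumer`,
`suppIn_yzNumer`, `unit_mem_support_yz`, **`originUnique_yzLaurent`** (cube criterion of `SporadicDworkCongruences`);
**`yangZudilin_dwork_congruence`**, stated as a congruence of natural numbers
`u_{n+mp^s} u_{⌊n/p⌋} ≡ u_n u_{⌊(n+mp^s)/p⌋} (mod p^s)` for all `s, m, n ≥ 0` (the printed (D3) shape).

Nearest existing declarations (used, not restated): `AperyLucasCongruences.genApery` (with its Lucas congruence
`genApery_modEq_mul`, the case `s = 1`), `AperyGaussCongruences.ossS` (`𝒮(n;4,0,0) = genApery 4 0 n` by `ossS_zero`),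
`DombDworkCongruences.{U, coeff_C_mul_X_add_C_pow, neg_nsmul_negOnes_three, single_eq_expVec3, suppIn_X,
suppIn_monomials}`, `SporadicDworkCongruences.{unitCube, originUnique_of_cube, …}`,
`AperyZetaThreeDworkCongruences.{toLaurent, coeff_toLaurent, X1, X2, X3}`, `AperyDworkCongruences.{q, q_coeff}`.
-/

noncomputable section

open Finset Polynomial Pointwise

namespace Literature.Combinatorics.Enumerative.YangZudilinDworkCongruences

open Literature.NumberTheory.Congruences.DworkCongruences
open Literature.Combinatorics.Enumerative.AperyDworkCongruences (q q_coeff latticeEmb_apply)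
open Literature.Combinatorics.Enumerative.AperyZetaThreeDworkCongruences (expVec expVec_zero expVec_one expVec_two
  expVec_add nsmul_expVec X1 X2 X3 toL1 toL2 coeff_toLaurent)
open Literature.Combinatorics.Enumerative.SporadicDworkCongruences (unitCube convex_unitCube zero_mem_unitCube
  suppIn_unitCube_single suppIn_unitCube_one negOnes support_mul_single_negOnes originUnique_of_cube)
open Literature.Combinatorics.Enumerative.DombDworkCongruences (U coeff_C_mul_X_add_C_pow neg_nsmul_negOnes_three
  single_eq_expVec3 suppIn_X suppIn_monomials)
open Literature.Combinatorics.Enumerative.AperyLucasCongruences (genApery)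

/-! ## The Laurent polynomial `Λ = (x_1+1)(x_2+1)(x_3+1)(x_1x_2x_3+1)/(x_1x_2x_3)` -/

/-- `A = (1 + x_3)(x_2 + 1)`, a polynomial in `x_2` over `ℤ[x_3]`. [cite: Gorodetsky2021, Prop. 3.3 (row `s_10`)] -/
def A : ℤ[X][X] := C q * (X + C 1)

/-- The numerator `(x_1+1)(x_2+1)(x_3+1)(x_1x_2x_3+1) = A · (x_1 + 1)(U x_1 + 1)` (`U = x_2x_3`) as a polynomial in
`x_1` over `ℤ[x_3][x_2]`. [cite: Gorodetsky2021, Prop. 3.3 (row `s_10`)] -/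
def yzNumer : ℤ[X][X][X] := C A * ((X + C 1) * (C U * X + C 1))

/-- Gorodetsky's Laurent polynomial for `s_10`: `Λ = (x+1)(y+1)(z+1)(xyz+1)/(xyz)`.
[cite: Gorodetsky2021, Prop. 3.3 (row `s_10`)] -/
def yzLaurent : LaurentPoly ℤ 3 :=
  AperyZetaThreeDworkCongruences.toLaurent yzNumer * AddMonoidAlgebra.single (negOnes 3) 1

/-! ## `CT[Λ^n] = Σ_k C(n,k)⁴` -/

/-- `[x_1^n] numer^n = A^n Σ_a C(n,a)² U^{n−a}`. [cite: Gorodetsky2021, Prop. 3.3 (row `s_10`)] -/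
theorem coeff_yzNumer_pow (n : ℕ) : (yzNumer ^ n).coeff n =
    A ^ n * ∑ a ∈ range (n + 1), ((n.choose a : ℤ[X][X]) * (n.choose a : ℤ[X][X])) * U ^ (n - a) := by
  rw [yzNumer, mul_pow (M := ℤ[X][X][X]), ← map_pow, coeff_C_mul, mul_pow (M := ℤ[X][X][X]), coeff_mul,
    Finset.Nat.sum_antidiagonal_eq_sum_range_succ_mk]
  congr 1
  refine Finset.sum_congr rfl fun a ha => ?_
  rw [Finset.mem_range, Nat.lt_succ_iff] at ha
  simp only
  rw [coeff_X_add_C_pow, coeff_C_mul_X_add_C_pow U 1 (Nat.sub_le n a), one_pow, one_pow, one_mul, mul_one,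
    Nat.choose_symm ha]
  ring

/-- `[x_2^n] A^n U^{n−a} = (1+x_3)^n x_3^{n−a} C(n,a)` (`a ≤ n`). [cite: Gorodetsky2021, Prop. 3.3 (row `s_10`)] -/
theorem coeff_A_pow_mul_U_pow {n a : ℕ} (ha : a ≤ n) :
    (A ^ n * U ^ (n - a)).coeff n = q ^ n * X ^ (n - a) * (n.choose a : ℤ[X]) := by
  rw [A, U, mul_pow, ← map_pow, mul_pow, ← map_pow,
    show C (q ^ n) * (X + C 1) ^ n * (C (X ^ (n - a)) * X ^ (n - a)) =
      C (q ^ n * X ^ (n - a)) * (X ^ (n - a) * (X + C (1 : ℤ[X])) ^ n) by rw [map_mul]; ring,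
    coeff_C_mul, coeff_X_pow_mul', if_pos (Nat.sub_le n a), coeff_X_add_C_pow, one_pow, one_mul,
    Nat.sub_sub_self ha]

/-- `[x_1^n x_2^n x_3^n] numer^n = Σ_k C(n,k)⁴` (the tree's `genApery 4 0 n`).
[cite: Gorodetsky2021, Prop. 3.3 (row `s_10`), §1.3 (`u^{(r,s,ε)}_n = Σ_k C(n,k)^r C(n+k,k)^s ε^k` includes `s_10`)] -/
theorem coeff3_yzNumer_pow (n : ℕ) : (((yzNumer ^ n).coeff n).coeff n).coeff n = (genApery 4 0 n : ℤ) := by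
  rw [coeff_yzNumer_pow, Finset.mul_sum, finsetSum_coeff, finsetSum_coeff, genApery, Nat.cast_sum]
  refine Finset.sum_congr rfl fun a ha => ?_
  have ha' : a ≤ n := by rw [Finset.mem_range] at ha; omega
  rw [mul_left_comm, ← C_eq_natCast, ← map_mul, coeff_C_mul, coeff_A_pow_mul_U_pow ha', ← C_eq_natCast,
    show C (n.choose a : ℤ) * C (n.choose a : ℤ) * (q ^ n * X ^ (n - a) * C (n.choose a : ℤ)) =
      C ((n.choose a : ℤ) * (n.choose a) * (n.choose a)) * (X ^ (n - a) * q ^ n) by rw [map_mul, map_mul]; ring,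
    coeff_C_mul, coeff_X_pow_mul', if_pos (Nat.sub_le n a), Nat.sub_sub_self ha', q, coeff_one_add_X_pow,
    pow_zero, mul_one]
  push_cast
  ring

/-- **`CT[Λ^n] = Σ_k C(n,k)⁴`.** [cite: Gorodetsky2021, Prop. 3.3 (row `s_10`)] -/
theorem ctPow_yzLaurent (n : ℕ) : ctPow yzLaurent n = (genApery 4 0 n : ℤ) := by
  unfold ctPow constTerm yzLaurent
  rw [mul_pow, ← map_pow, AddMonoidAlgebra.single_pow, one_pow, AddMonoidAlgebra.coeff_mul_single_apply, mul_one,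
    zero_add, neg_nsmul_negOnes_three, coeff_toLaurent, coeff3_yzNumer_pow]

/-! ## The Newton polytope -/

/-- `Λ · x_1x_2x_3 = (1+x_1)(1+x_2)(1+x_3) · (1 + x_1x_2x_3)`, the first factor expanded into its eight square-free
monomials. [cite: Gorodetsky2021, Prop. 3.3 (row `s_10`)] -/
theorem toLaurent_yzNumer : AperyZetaThreeDworkCongruences.toLaurent yzNumer =
    (1 + X1 + X2 + X3 + X1 * X2 + X1 * X3 + X2 * X3 + X1 * X2 * X3) * (1 + X1 * X2 * X3) := by
  simp only [AperyZetaThreeDworkCongruences.toLaurent, toL2, toL1, yzNumer, A, U, q, Polynomial.coe_eval₂RingHom,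
    eval₂_mul, eval₂_add, eval₂_C, eval₂_X, eval₂_one]
  ring

/-- The numerator's exponents lie in `2 · [0,1]³`. [cite: Gorodetsky2021, §3.6] -/
theorem suppIn_yzNumer : SuppIn (unitCube 3) (AperyZetaThreeDworkCongruences.toLaurent yzNumer) 2 := by
  obtain ⟨h1, h2, h3⟩ := suppIn_X
  obtain ⟨h12, h13, h23, h123⟩ := suppIn_monomials
  have hA : SuppIn (unitCube 3) (1 + X1 + X2 + X3 + X1 * X2 + X1 * X3 + X2 * X3 + X1 * X2 * X3) 1 :=
    ((((((suppIn_unitCube_one.add h1).add h2).add h3).add h12).add h13).add h23).add h123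
  have hB : SuppIn (unitCube 3) (1 + X1 * X2 * X3) 1 := suppIn_unitCube_one.add h123
  rw [toLaurent_yzNumer, show (2 : ℝ) = 1 + 1 by norm_num]
  exact hA.mul convex_unitCube hB zero_le_one zero_le_one

/-- `numer = C(AU) x_1² + C(A + AU) x_1 + C A`. [cite: Gorodetsky2021, Prop. 3.3 (row `s_10`)] -/
theorem yzNumer_eq : yzNumer = C (A * U) * X ^ 2 + C (A + A * U) * X + C A := by
  simp only [yzNumer, map_add, map_mul, map_one]
  ring

/-- `[x_1²] numer = AU`. [cite: Gorodetsky2021, Prop. 3.3 (row `s_10`)] -/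
theorem yzNumer_coeff_two : yzNumer.coeff 2 = A * U := by
  rw [yzNumer_eq]
  simp only [coeff_add, coeff_C_mul_X_pow, coeff_C_mul_X, coeff_C]
  simp

/-- `[x_1] numer = A + AU`. [cite: Gorodetsky2021, Prop. 3.3 (row `s_10`)] -/
theorem yzNumer_coeff_one : yzNumer.coeff 1 = A + A * U := by
  rw [yzNumer_eq]
  simp only [coeff_add, coeff_C_mul_X_pow, coeff_C_mul_X, coeff_C]
  simp

/-- `[x_1⁰] numer = A`. [cite: Gorodetsky2021, Prop. 3.3 (row `s_10`)] -/
theorem yzNumer_coeff_zero : yzNumer.coeff 0 = A := by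
  rw [yzNumer_eq]
  simp only [coeff_add, coeff_C_mul_X_pow, coeff_C_mul_X, coeff_C]
  simp

/-- `A = C(1+x_3) x_2 + C(1+x_3)`. [cite: Gorodetsky2021, Prop. 3.3 (row `s_10`)] -/
theorem A_eq : A = C q * X + C q := by
  rw [A, map_one]; ring

/-- `AU = C(x_3(1+x_3)) x_2² + C(x_3(1+x_3)) x_2`. [cite: Gorodetsky2021, Prop. 3.3 (row `s_10`)] -/
theorem AU_eq : A * U = C (q * X) * X ^ 2 + C (q * X) * X := by
  simp only [A, U, map_mul, map_one]
  ring

/-- `A + AU = C(x_3(1+x_3)) x_2² + C((1+x_3) + x_3(1+x_3)) x_2 + C(1+x_3)`.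
[cite: Gorodetsky2021, Prop. 3.3 (row `s_10`)] -/
theorem A_add_AU_eq : A + A * U = C (q * X) * X ^ 2 + C (q + q * X) * X + C q := by
  simp only [A, U, map_mul, map_add, map_one]
  ring

/-- `[x_2] A = 1 + x_3`. [cite: Gorodetsky2021, Prop. 3.3 (row `s_10`)] -/
theorem A_coeff_one : A.coeff 1 = q := by
  rw [A_eq]; simp only [coeff_add, coeff_C_mul_X, coeff_C]; simp

/-- `[x_2] AU = x_3(1+x_3)`. [cite: Gorodetsky2021, Prop. 3.3 (row `s_10`)] -/
theorem AU_coeff_one : (A * U).coeff 1 = q * X := by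
  rw [AU_eq]; simp only [coeff_add, coeff_C_mul_X_pow, coeff_C_mul_X]; simp

/-- `[x_2²] (A + AU) = x_3(1+x_3)`. [cite: Gorodetsky2021, Prop. 3.3 (row `s_10`)] -/
theorem AAU_coeff_two : (A + A * U).coeff 2 = q * X := by
  rw [A_add_AU_eq]; simp only [coeff_add, coeff_C_mul_X_pow, coeff_C_mul_X, coeff_C]; simp

/-- `[x_2] (A + AU) = (1+x_3) + x_3(1+x_3)`. [cite: Gorodetsky2021, Prop. 3.3 (row `s_10`)] -/
theorem AAU_coeff_one : (A + A * U).coeff 1 = q + q * X := by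
  rw [A_add_AU_eq]; simp only [coeff_add, coeff_C_mul_X_pow, coeff_C_mul_X, coeff_C]; simp

/-- `[x_2⁰] (A + AU) = 1 + x_3`. [cite: Gorodetsky2021, Prop. 3.3 (row `s_10`)] -/
theorem AAU_coeff_zero : (A + A * U).coeff 0 = q := by
  rw [A_add_AU_eq]; simp only [coeff_add, coeff_C_mul_X_pow, coeff_C_mul_X, coeff_C]; simp

/-- Coefficients of `Λ` in terms of the numerator. [cite: Gorodetsky2021, Prop. 3.3 (row `s_10`)] -/
theorem coeff_yzLaurent (a b c : ℤ) (i j k : ℕ) (ha : a + 1 = i) (hb : b + 1 = j) (hc : c + 1 = k) :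
    yzLaurent.coeff (expVec a b c) = ((yzNumer.coeff i).coeff j).coeff k := by
  rw [yzLaurent, AddMonoidAlgebra.coeff_mul_single_apply, mul_one,
    show expVec a b c + -negOnes 3 = expVec (i : ℤ) (j : ℤ) (k : ℤ) by
      rw [← ha, ← hb, ← hc]; ext l; fin_cases l <;> simp [negOnes],
    coeff_toLaurent]

/-- `∀` over `Fin 3` as a conjunction (plumbing). [folklore] -/
private theorem forall_fin_three {P : Fin 3 → Prop} : (∀ i, P i) ↔ P 0 ∧ P 1 ∧ P 2 :=
  ⟨fun h => ⟨h 0, h 1, h 2⟩, fun h i => by fin_cases i <;> [exact h.1; exact h.2.1; exact h.2.2]⟩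

/-- The exponents `±e_1, ±e_2, ±e_3` occur in `Λ` (all with coefficient `1`). [cite: Gorodetsky2021, §3.6] -/
theorem unit_mem_support_yz :
    (∀ i : Fin 3, Pi.single i (1 : ℤ) ∈ yzLaurent.coeff.support) ∧
      ∀ i : Fin 3, Pi.single i (-1 : ℤ) ∈ yzLaurent.coeff.support := by
  obtain ⟨p0, p1, p2⟩ := single_eq_expVec3 1
  obtain ⟨m0, m1, m2⟩ := single_eq_expVec3 (-1)
  rw [forall_fin_three, forall_fin_three, p0, p1, p2, m0, m1, m2]
  simp only [Finsupp.mem_support_iff]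
  refine ⟨⟨?_, ?_, ?_⟩, ?_, ?_, ?_⟩
  · rw [coeff_yzLaurent 1 0 0 2 1 1 (by norm_num) (by norm_num) (by norm_num), yzNumer_coeff_two, AU_coeff_one,
      coeff_mul_X, q_coeff]
    simp
  · rw [coeff_yzLaurent 0 1 0 1 2 1 (by norm_num) (by norm_num) (by norm_num), yzNumer_coeff_one, AAU_coeff_two,
      coeff_mul_X, q_coeff]
    simp
  · rw [coeff_yzLaurent 0 0 1 1 1 2 (by norm_num) (by norm_num) (by norm_num), yzNumer_coeff_one, AAU_coeff_one,
      coeff_add, coeff_mul_X, q_coeff, q_coeff]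
    simp
  · rw [coeff_yzLaurent (-1) 0 0 0 1 1 (by norm_num) (by norm_num) (by norm_num), yzNumer_coeff_zero, A_coeff_one,
      q_coeff]
    simp
  · rw [coeff_yzLaurent 0 (-1) 0 1 0 1 (by norm_num) (by norm_num) (by norm_num), yzNumer_coeff_one, AAU_coeff_zero,
      q_coeff]
    simp
  · rw [coeff_yzLaurent 0 0 (-1) 1 1 0 (by norm_num) (by norm_num) (by norm_num), yzNumer_coeff_one, AAU_coeff_one,
      coeff_add, coeff_mul_X_zero, q_coeff]
    simp

/-- The Newton polytope of `Λ` has the origin as its only interior lattice point.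
[cite: Gorodetsky2021, Thm. 1.1 / §3.6 (row `s_10`)] -/
theorem originUnique_yzLaurent : OriginUniqueInteriorLatticePoint yzLaurent :=
  originUnique_of_cube yzLaurent three_pos
    (fun _ hv => by rw [yzLaurent] at hv; exact support_mul_single_negOnes suppIn_yzNumer hv)
    unit_mem_support_yz.1 unit_mem_support_yz.2

/-- **Dwork (D3) congruences for the Yang–Zudilin numbers** `u_n = Σ_k C(n,k)⁴`, in the printed (D3) form and as a
congruence of natural numbers: for every prime `p` and all `s, m, n ≥ 0`,
`u_{n+mp^s} u_{⌊n/p⌋} ≡ u_n u_{⌊(n+mp^s)/p⌋} (mod p^s)`.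
[cite: Gorodetsky2021, Cor. 2.4 with (D3) of §2.1 (Prop. 3.3 row `s_10`, Thm. 2.3)] -/
theorem yangZudilin_dwork_congruence {p : ℕ} (hp : p.Prime) (s m n : ℕ) :
    genApery 4 0 (n + m * p ^ s) * genApery 4 0 (n / p) ≡ genApery 4 0 n * genApery 4 0 ((n + m * p ^ s) / p)
      [MOD p ^ s] := by
  rcases Nat.eq_zero_or_pos s with rfl | hs
  · rw [pow_zero]
    exact Nat.modEq_one
  have hR : ∀ a : ℤ, (p : ℤ) ∣ a ^ p - a := fun a => by
    haveI := Fact.mk hp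
    rw [← ZMod.intCast_zmod_eq_zero_iff_dvd]
    push_cast
    rw [ZMod.pow_card, sub_self]
  have h := dwork_congruence hp hR yzLaurent originUnique_yzLaurent hs n m
  simp only [ctPow_yzLaurent] at h
  have hdiv : (n + m * p ^ s) / p = n / p + m * p ^ (s - 1) := by
    obtain ⟨t, rfl⟩ : ∃ t, s = t + 1 := ⟨s - 1, by omega⟩
    rw [Nat.add_sub_cancel, pow_succ, ← mul_assoc, Nat.add_mul_div_right _ _ hp.pos]
  rw [hdiv, ← Int.natCast_modEq_iff]
  push_cast
  exact (Int.modEq_iff_dvd.2 h).symm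

end Literature.Combinatorics.Enumerative.YangZudilinDworkCongruences
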